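import Mathlib.RingTheory.MvPolynomial.Homogeneous
import Mathlib.Algebra.MvPolynomial.PDeriv
import Mathlib.Data.Set.Card
import Mathlib.Data.Complex.Basic
import Literature.Computability.AlgebraicComplexity.DeterminantalComplexity
import HarnessLib

/-!
# Sheshadri's determinantal conormal bound (arXiv:2606.13628, Thm. 3 (i)) in polar-count form

Named fact (an UNREFEREED 2026 claim, D-0012) requested by route
`ValiantsHypothesis/BirkhoffNewtonClass` (`wi-13763`; crux `DeterminantalConormalBound`,
`stmt-ValiantsHypothesis-4915`), also the engine of route `ValiantsHypothesis/PermanentClass`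
(crux `KernelIncidenceBound`).

## The printed theorem

K. Sheshadri, *A near-quadratic lower bound on the border determinantal complexity of `Σᵢ xᵢⁿ`
via conormal specialization*, arXiv:2606.13628 (2026; the paper discloses extensive LLM
assistance), **Theorem 3 (Determinantal conormal bound) (i)**: let `n ≥ 2`, `m ≥ 1`,
`A(x) = A₀ + Σ_{i=1}^n xᵢ Aᵢ` an `m × m` matrix of affine-linear forms over `ℂ`,
`Â = x₀A₀ + Σ xᵢAᵢ` its homogenisation, `F := det Â ≢ 0`. Then
`pdeg_{n−2}(G₁(F)) ≤ B(m, n) := Σ_{i=1}^{n−1} C(m,i) C(m−1,n−1−i) C(n−2,i−1)`, where `G₁(F)` is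
the multiplicity-one Gauss-graph cycle of `V(F) ⊂ ℙⁿ` (Def. 1; = `Σ_{k_j = 1} Con(S_j)` over the
components `S_j` of multiplicity `k_j = 1`, Lemma 1) and `pdeg_k` are the multidegrees of
`(n−1)`-cycles on `ℙⁿ × (ℙⁿ)^∨` (§2.1). No smoothness, reducedness or genericity hypothesis.
Inputs of its proof: Lemma 4 (Kleiman transversality, char. 0 — Kleiman 1974, Compositio Math.
28), Lemma 5 (Bézout bound for isolated zeros of a section of a direct sum of globally generated
line bundles on a product of projective spaces — Fulton, *Intersection Theory*, Ch. 12), and the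
local normal form of §3.1, Steps 2–5 (kernel lift to `ℙⁿ × ℙ^{m−1} × ℙ^{m−1}`, generic
`Λ`-reduction, Schur complement; Step 5 shows every count point lifts to a REDUCED ISOLATED point
of the square system of Step 4 — read and found in order by the vendor: the ideal computation
`I = (u′ᵀ + rB⁻¹, v′ + B⁻¹c, g)` exhibits the bilinear block as the graph over the smooth germ
`(S_j, x*)`, and the `n − 1` remaining equations restrict to unit multiples of the flag
functions, transverse by Step 1).

## The form vendored here (what the routes consume) and how it follows

The tree has no conormal varieties / multidegrees. Both routes speak the ELEMENTARY avatar of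
the top multidegree of the conormal cycle of a hypersurface `V(f) ⊂ ℙ^{N−1}`, `f` a form in
`N` variables: the number of points of the **polar (tangency) set**
`T_f(a, b, c) = {x ∈ ℂ^N : f(x) = 0, ∇f(x) ≠ 0, ∇f(x) ∈ ℂa + ℂb, Σ cᵢxᵢ = 1}`
(smooth points of `V(f)_red`, one affine representative each on the chart `c·x = 1`, whose
tangent hyperplane lies on the pencil spanned by `a, b`) for GENERIC `(a, b, c)` — genericity
encoded, as in the routes, by "outside the zero set of one non-zero polynomial `Φ` in the data".
`Literature.Computability.AlgebraicComplexity.Sheshadri2026_polarCount_le` asserts: for `f`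
homogeneous of degree `d` in `N ≥ 3` variables with an affine determinantal representation of
size `m` (`HasDetRepr f m`), generically `#T_f(a,b,c) ≤ B(m, N)`.

Derivation from the paper (Remark 3 there is the smooth case): write `f = det(A₀ + Σ xᵢAᵢ)`;
then `F := det(x₀A₀ + Σ xᵢAᵢ) = x₀^m f(x/x₀) = x₀^{m−d} f` on `ℙ^N` (if `f = 0` or `d = 0` the
polar set is empty). Factor `f = Π g_j^{k_j}`; the components of `V(F)` are `V(x₀)` (if `m > d`)
and the cones `X_j ⊂ ℙ^N` over `Z_j = V(g_j) ⊂ ℙ^{N−1} = {x₀ = 0}`, of multiplicity `k_j`, so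
`G₁(F) ⊇ Σ_{k_j=1} Con(X_j)` (Lemma 1) and, multidegrees of effective cycles being non-negative
(Lemma 4), `Σ_{k_j=1} pdeg_{N−2}(Con X_j) ≤ pdeg_{N−2}(G₁(F)) ≤ B(m, N)` (Thm. 3 (i), `n = N`).
Every tangent hyperplane of a cone contains the vertex, so `Con(X_j) → Con(Z_j)` is the
`ℙ¹`-bundle of rulings and the two-stage count of the proof of Prop. 2 (c) (printed for smooth
`Z`; its last step `= deg Z^∨` is the only place smoothness is used) gives
`pdeg_{N−2}(Con X_j) = pdeg_{N−2}(Con Z_j)`, the TOP multidegree of `Con(Z_j) ⊂ ℙ^{N−1} × (ℙ^{N−1})^∨`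
(`N ≥ 3`: a generic plane of `(ℙ^N)^∨` misses the vertex covector). By Lemma 4 again (flag
`ℙ^{N−1} × L`, `L` a generic line = pencil, opens = the graph parts `{(x, [df(x)])}`), for generic
pencils `Σ_{k_j=1} pdeg_{N−2}(Con Z_j)` is the number of `[x] ∈ ℙ^{N−1}` with `f(x) = 0`,
`df(x) ≠ 0`, `[df(x)] ∈ L` (a point with `df ≠ 0` lies on exactly one component, of multiplicity
one, and is a smooth point of `V(f)_red`); the chart `c·x = 1` picks at most one representative of
each. "Generic pencil" is a dense open condition on `(a, b) ∈ ℂ^N × ℂ^N` (preimage of a dense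
open subset of the Grassmannian under the dominant map `(a, b) ↦ ℂa + ℂb`), hence contains a
basic open set `{Φ ≠ 0}`, `Φ ≠ 0`. The symmetric bound (ii) (`2^{n−2} C(m, n−1)`) is not vendored.

## Contents

* `conormalBezout m N = B(m, N)` with `conormalBezout_eq_zero_of_lt` (`B(m,N) = 0` for
  `2m < N`: the Mignon–Ressayre-type floor "class ≥ 1 ⇒ m ≥ N/2"), `conormalBezout_four_four`
  (`B(4,4) = 52`), `conormalBezout_three` (`B(m,3) = 3·C(m,2)`);
* `polarSet f a b c` — the polar (tangency) set `T_f(a,b,c)`;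
* the named fact `Sheshadri2026_polarCount_le` and its instance for the permanent,
  `Sheshadri2026_polarCount_le.permanent` (the shape of route item `DeterminantalConormalBound`).

## References

* K. Sheshadri, arXiv:2606.13628 (2026): Thm. 3 (i), Def. 1, Lemmas 1, 2, 4, 5, §3.1 Steps 1–6,
  Prop. 2, Remark 3, Lemma 18. [Sheshadri2026Border] — unrefereed claim.
* K. Sheshadri, arXiv:2606.11090 (2026), Remark 5 (smooth symmetric precursor). [Sheshadri2026SDC]
* T. Mignon, N. Ressayre, *A quadratic bound for the determinant and permanent problem*, IMRN
  2004 (`dc(per_n) ≥ n²/2`). [MignonRessayre2004]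
* S. L. Kleiman, *The transversality of a general translate*, Compositio Math. 28 (1974) 287–297;
  W. Fulton, *Intersection Theory*, 2nd ed., Springer 1998, Ch. 12. [Fulton1998]
-/

noncomputable section

open MvPolynomial

namespace Literature.Computability.AlgebraicComplexity

/-! ### The two-kernel Bézout number `B(m, N)` -/

/-- Sheshadri's two-kernel Bézout number
`B(m, N) = [xᴺ u^{m−1} v^{m−1}] x (x+u)^m (x+v)^{m−1} (u+v)^{N−2}`
`= Σ_{i=1}^{N−1} C(m, i) · C(m−1, N−1−i) · C(N−2, i−1)` (closed form of Thm. 3 (i), Step 6).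
[claim: Sheshadri2026Border, status: under-review] -/
def conormalBezout (m N : ℕ) : ℕ :=
  ∑ i ∈ Finset.Icc 1 (N - 1), m.choose i * (m - 1).choose (N - 1 - i) * (N - 2).choose (i - 1)

/-- `B(m, N) = 0` when `2m < N`: in every term either `i > m` or `N − 1 − i > m − 1`, so a
binomial coefficient vanishes (the source of the `n²/2`-type floor: a hypersurface of class `≥ 1`
in `N` variables needs `m ≥ N/2`). [folklore] -/
theorem conormalBezout_eq_zero_of_lt {m N : ℕ} (h : 2 * m < N) : conormalBezout m N = 0 := by
  refine Finset.sum_eq_zero fun i hi => ?_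
  rw [Finset.mem_Icc] at hi
  by_cases him : m < i
  · rw [Nat.choose_eq_zero_of_lt him, zero_mul, zero_mul]
  · have : m - 1 < N - 1 - i := by omega
    rw [Nat.choose_eq_zero_of_lt this, mul_zero, zero_mul]

/-- `B(4, 4) = 12 + 36 + 4 = 52`. [folklore] -/
theorem conormalBezout_four_four : conormalBezout 4 4 = 52 := by
  decide

/-- `B(m, 3) = m(m−1) + C(m,2) = 3·C(m, 2)`. [folklore] -/
theorem conormalBezout_three (m : ℕ) : conormalBezout m 3 = 3 * m.choose 2 := by
  have hIcc : Finset.Icc 1 (3 - 1) = {1, 2} := by decide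
  have heven : 2 * (m * (m - 1) / 2) = m * (m - 1) :=
    Nat.two_mul_div_two_of_even (Nat.even_mul_pred_self m)
  rw [conormalBezout, hIcc, Finset.sum_pair (by decide)]
  simp only [Nat.choose_one_right, Nat.choose_zero_right, Nat.choose_self, Nat.choose_two_right,
    Nat.reduceSub, mul_one]
  rcases m with _ | m
  · simp
  · simp only [Nat.add_sub_cancel] at heven ⊢
    omega

/-! ### The polar (tangency) set of a form w.r.t. a pencil and a chart -/

/-- The **polar (tangency) set** `T_f(a, b, c)` of `f ∈ ℂ[x_σ]` with respect to the pencil of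
hyperplanes spanned by the covectors `a, b` and the affine chart `Σ cᵢ xᵢ = 1`: the points `x`
with `f(x) = 0`, `∇f(x) ≠ 0` (smooth points of `V(f)_red`), `∇f(x) ∈ ℂa + ℂb` (tangent hyperplane
on the pencil) and `c · x = 1` (one representative of each projective point on the chart). For a
form `f` and generic `(a, b, c)` its cardinality is the class-type count both `ValiantsHypothesis`
routes use (elementary avatar of the top multidegree of the conormal cycle of `V(f)`). [folklore] -/
def polarSet {σ : Type*} [Fintype σ] (f : MvPolynomial σ ℂ) (a b c : σ → ℂ) : Set (σ → ℂ) :=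
  {x | eval x f = 0 ∧ (∃ i, eval x (pderiv i f) ≠ 0) ∧
    (∃ s t : ℂ, ∀ i, eval x (pderiv i f) = s * a i + t * b i) ∧ ∑ i, c i * x i = 1}

/-- Membership in `polarSet`, unfolded. [folklore] -/
theorem mem_polarSet {σ : Type*} [Fintype σ] {f : MvPolynomial σ ℂ} {a b c x : σ → ℂ} :
    x ∈ polarSet f a b c ↔ eval x f = 0 ∧ (∃ i, eval x (pderiv i f) ≠ 0) ∧
      (∃ s t : ℂ, ∀ i, eval x (pderiv i f) = s * a i + t * b i) ∧ ∑ i, c i * x i = 1 :=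
  Iff.rfl

/-- The polar set of the zero polynomial is empty (no point has `∇f ≠ 0`). [folklore] -/
theorem polarSet_zero {σ : Type*} [Fintype σ] (a b c : σ → ℂ) :
    polarSet (0 : MvPolynomial σ ℂ) a b c = ∅ := by
  ext x
  simp [polarSet]

/-! ### The named fact -/

/-- UNREFEREED CLAIM — **Sheshadri's determinantal conormal bound, polar-count form**
(arXiv:2606.13628, Thm. 3 (i), through Lemmas 1, 4 and the two-stage cone count of the proof of
Prop. 2 (c) — printed there for a smooth base, used here for an arbitrary hypersurface, where the
same count applies verbatim; see the module docstring for the derivation and its inputs): let `σ` be a finite index type with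
`N = |σ| ≥ 3`, `f ∈ ℂ[x_σ]` homogeneous of degree `d`, and suppose `f = det A` for an `m × m`
matrix `A` of affine-linear forms (`HasDetRepr f m`). Then there is a non-zero polynomial `Φ` in
the pencil/chart data `u = (a, b, c) ∈ (ℂ^σ)³` such that for every `u` with `Φ(u) ≠ 0` the polar
set `T_f(a, b, c)` (`polarSet`) has at most
`B(m, N) = Σ_{i=1}^{N−1} C(m,i) C(m−1,N−1−i) C(N−2,i−1)` (`conormalBezout m N`) points. No
smoothness, irreducibility or reducedness of `V(f)` is assumed. Users take
`(h : Sheshadri2026_polarCount_le)`. [claim: Sheshadri2026Border, status: under-review] -/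
def Sheshadri2026_polarCount_le : Prop :=
  ∀ ⦃σ : Type⦄ [Fintype σ] [DecidableEq σ], 3 ≤ Fintype.card σ →
    ∀ (f : MvPolynomial σ ℂ) (d m : ℕ), f.IsHomogeneous d → HasDetRepr f m →
      ∃ Φ : MvPolynomial (Fin 3 × σ) ℂ, Φ ≠ 0 ∧ ∀ u : Fin 3 × σ → ℂ, eval u Φ ≠ 0 →
        (polarSet f (fun i => u (0, i)) (fun i => u (1, i)) (fun i => u (2, i))).ncard ≤
          conormalBezout m (Fintype.card σ)

/-- **The permanent instance** (the shape of route item `DeterminantalConormalBound`): for `n ≥ 2`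
and every `m` with `HasDetRepr (per_n) m`, for generic pencil/chart data the polar set of the
permanental hypersurface `P_n ⊂ ℙ^{n²−1}` has at most `B(m, n²)` points (`per_n` is homogeneous
of degree `n`, `perPoly_isHomogeneous`; `n² ≥ 4 ≥ 3`). [claim: Sheshadri2026Border, status: under-review] -/
theorem Sheshadri2026_polarCount_le.permanent (h : Sheshadri2026_polarCount_le) (n : ℕ)
    (hn : 2 ≤ n) (m : ℕ) (hm : HasDetRepr (perPoly (Fin n) ℂ) m) :
    ∃ Φ : MvPolynomial (Fin 3 × (Fin n × Fin n)) ℂ, Φ ≠ 0 ∧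
      ∀ u : Fin 3 × (Fin n × Fin n) → ℂ, eval u Φ ≠ 0 →
        (polarSet (perPoly (Fin n) ℂ) (fun i => u (0, i)) (fun i => u (1, i))
            (fun i => u (2, i))).ncard ≤ conormalBezout m (n * n) := by
  have hcard : Fintype.card (Fin n × Fin n) = n * n := by simp
  have h3 : 3 ≤ Fintype.card (Fin n × Fin n) := by rw [hcard]; nlinarith
  simpa [hcard] using h h3 (perPoly (Fin n) ℂ) (Fintype.card (Fin n)) m perPoly_isHomogeneous hm

end Literature.Computability.AlgebraicComplexity
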